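import Mathlib.Algebra.MvPolynomial.Equiv
import Mathlib.RingTheory.Polynomial.GaussLemma
import Mathlib.RingTheory.AlgebraicIndependent.Transcendental
import Mathlib.FieldTheory.Minpoly.Field
import Mathlib.FieldTheory.IntermediateField.Adjoin.Basic
import Mathlib.FieldTheory.IsAlgClosed.Basic
import Mathlib.RingTheory.Localization.Integral
import Mathlib.RingTheory.Adjoin.Polynomial.Basic
import Mathlib.Algebra.Algebra.Rat
import Mathlib.Algebra.Polynomial.Lifts
import HarnessLib

/-!
# Zeros of an irreducible integer polynomial in two variables with a transcendental coordinate

Folklore facts about the plane curve `P(x, y) = 0`, `P ∈ ℤ[x, y]` (variables `0 = x`, `1 = y`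
of `MvPolynomial (Fin 2) ℤ`), over a field `E` of characteristic zero:

* `exists_aeval_eq_zero_of_degreeOf_pos` — if `P` has positive degree in `x` and `E` is
  algebraically closed, then for every `τ ∈ E` transcendental over `ℚ` there is `ε ∈ E` with
  `P(ε, τ) = 0` (the leading coefficient of `P` as a polynomial in `x` is a non-zero integer
  polynomial in `y`, so does not vanish at `τ`).
* `transcendental_of_aeval_eq_zero` (and the symmetric `transcendental_of_aeval_eq_zero'`) —
  if `P` is irreducible in `ℤ[x, y]` with positive degree in `x`, `P(x₀, x₁) = 0` and `x₀` is
  transcendental over `ℚ`, then so is `x₁`. (If `x₁` were algebraic, `x₀` would be transcendental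
  over `ℚ(x₁)`, so every coefficient `c_j(y)` of `P = Σ c_j(y) xʲ` would vanish at `x₁`; by
  Gauss's lemma the primitive minimal polynomial of `x₁` would then divide `P` in `ℤ[x, y]`,
  contradicting irreducibility since `deg_x P > 0`.)

In other words a zero of an irreducible `P` with `deg_x P, deg_y P > 0` one of whose
coordinates is transcendental is a *generic* zero (both coordinates transcendental; the point
has transcendence degree `1`). This is the algebraic input for the base field
`ℚ^{ab}(τ, (ε_m))`, `(ε, τ)` "a generic zero of the polynomial `P(x, y)`", of Bays–Kirby's
pseudo-exponential fields `𝔹_P` incorporating a counterexample to Schanuel's conjecture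
(M. Bays, J. Kirby, Algebra & Number Theory 12 (2018), §9.2), see
`Literature/Barriers/Schanuel/AxiomsDoNotForceSchanuel.lean`.

Everything is proved; Mathlib supplies `MvPolynomial.finSuccEquiv` (a polynomial in `x, y` as a
polynomial in `x` over `ℤ[y]`), Gauss's lemma over `ℤ`
(`Polynomial.IsPrimitive.Int.dvd_iff_map_cast_dvd_map_cast`,
`Polynomial.IsPrimitive.Int.irreducible_iff_irreducible_map_cast`) and minimal polynomials.

## References

* M. Bays, J. Kirby, *Pseudo-exponential maps, variants, and quasiminimality*, Algebra & Number
  Theory 12 (2018) 493–549, §9.2.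
-/

noncomputable section

open Polynomial

namespace Literature.NumberTheory.Transcendental

namespace PlaneCurve

variable {E : Type*} [Field E]

/-! ### `P(x, y)` as a polynomial in `x` over `ℤ[y]` -/

/-- Evaluating `P ∈ ℤ[x, y]` at `(ε, τ)` through `MvPolynomial.finSuccEquiv`: map the
coefficients (polynomials in `y`) by `y ↦ τ`, then evaluate the resulting polynomial in `x` at
`ε`. [folklore] -/
theorem eval_map_finSuccEquiv (P : MvPolynomial (Fin 2) ℤ) (ε τ : E) :
    ((MvPolynomial.finSuccEquiv ℤ 1 P).map
        (MvPolynomial.aeval (fun _ : Fin 1 => τ) : MvPolynomial (Fin 1) ℤ →ₐ[ℤ] E).toRingHom).eval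
      ε = MvPolynomial.aeval ![ε, τ] P := by
  set s : MvPolynomial (Fin 1) ℤ →ₐ[ℤ] E := MvPolynomial.aeval (fun _ : Fin 1 => τ) with hs
  let f : MvPolynomial (Fin 2) ℤ →+* E :=
    (Polynomial.evalRingHom ε).comp ((Polynomial.mapRingHom s.toRingHom).comp
      (MvPolynomial.finSuccEquiv ℤ 1).toRingEquiv.toRingHom)
  have hfg : f = (MvPolynomial.aeval ![ε, τ] : MvPolynomial (Fin 2) ℤ →ₐ[ℤ] E).toRingHom := by
    refine MvPolynomial.ringHom_ext (fun r => ?_) (fun i => ?_)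
    · simp [f]
    · fin_cases i
      · simp [f, MvPolynomial.finSuccEquiv_X_zero]
      · have h1 : (MvPolynomial.X ⟨1, by norm_num⟩ : MvPolynomial (Fin 2) ℤ) =
            MvPolynomial.X (0 : Fin 1).succ := rfl
        have h2 : (MvPolynomial.finSuccEquiv ℤ 1).toRingEquiv.toRingHom
            (MvPolynomial.X (0 : Fin 1).succ) = Polynomial.C (MvPolynomial.X 0) :=
          MvPolynomial.finSuccEquiv_X_succ
        simp only [f, RingHom.coe_comp, Function.comp_apply, h1, h2, Polynomial.coe_mapRingHom,
          Polynomial.map_C, Polynomial.coe_evalRingHom, Polynomial.eval_C]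
        simp [hs]
  exact RingHom.congr_fun hfg P

/-- The evaluation `ℤ[y] → E`, `y ↦ τ`, is injective for `τ` transcendental over `ℚ`.
[folklore] -/
theorem aeval_injective_of_transcendental [CharZero E] {τ : E} (hτ : Transcendental ℚ τ) :
    Function.Injective
      (MvPolynomial.aeval (fun _ : Fin 1 => τ) : MvPolynomial (Fin 1) ℤ →ₐ[ℤ] E) := by
  have hτ' : Transcendental ℤ τ :=
    hτ.restrictScalars (algebraMap ℤ ℚ).injective_int
  have : AlgebraicIndependent ℤ (fun _ : Fin 1 => τ) :=
    algebraicIndependent_unique_type_iff.mpr hτ'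
  exact this

/-! ### Existence of a zero above a transcendental `τ` -/

/-- **A zero with prescribed transcendental second coordinate.** If `P ∈ ℤ[x, y]` has positive
degree in `x`, `E` is algebraically closed of characteristic zero and `τ ∈ E` is transcendental
over `ℚ`, then `P(ε, τ) = 0` for some `ε ∈ E`: the polynomial `P(x, τ) ∈ E[x]` has degree
`deg_x P > 0` because its leading coefficient is a non-zero integer polynomial evaluated at the
transcendental `τ`. [folklore] -/
theorem exists_aeval_eq_zero_of_degreeOf_pos [CharZero E] [IsAlgClosed E] {P : MvPolynomial (Fin 2) ℤ}
    (hd : 0 < P.degreeOf 0) {τ : E} (hτ : Transcendental ℚ τ) :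
    ∃ ε : E, MvPolynomial.aeval ![ε, τ] P = 0 := by
  set s : MvPolynomial (Fin 1) ℤ →ₐ[ℤ] E := MvPolynomial.aeval (fun _ : Fin 1 => τ) with hs
  set p : E[X] := (MvPolynomial.finSuccEquiv ℤ 1 P).map s.toRingHom with hp
  have hdeg : p.natDegree = P.degreeOf 0 := by
    rw [hp, Polynomial.natDegree_map_eq_of_injective (aeval_injective_of_transcendental hτ),
      MvPolynomial.natDegree_finSuccEquiv]
  have hp0 : p.degree ≠ 0 :=
    (Polynomial.natDegree_pos_iff_degree_pos.mp (hdeg ▸ hd)).ne'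
  obtain ⟨ε, hε⟩ := IsAlgClosed.exists_root p hp0
  exact ⟨ε, by rw [← eval_map_finSuccEquiv, ← hs, ← hp]; exact hε⟩

/-! ### Transcendence of the other coordinate -/

/-- An irreducible integer polynomial of positive degree is primitive. [folklore] -/
theorem isPrimitive_of_irreducible_of_natDegree_pos {g : ℤ[X]} (hg : Irreducible g)
    (hdeg : 0 < g.natDegree) : g.IsPrimitive := by
  rw [Polynomial.isPrimitive_iff_isUnit_of_C_dvd]
  rintro r ⟨q, hq⟩
  rcases hg.isUnit_or_isUnit hq with hu | hu
  · exact Polynomial.isUnit_C.mp hu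
  · exfalso
    obtain ⟨u, -, rfl⟩ := Polynomial.isUnit_iff.mp hu
    rw [← C_mul] at hq
    rw [hq, natDegree_C] at hdeg
    exact lt_irrefl 0 hdeg

/-- An algebraic element of a field of characteristic zero is a root of an irreducible,
primitive integer polynomial of positive degree. [folklore] -/
theorem exists_irreducible_isPrimitive_aeval_eq_zero [CharZero E] {a : E} (ha : IsAlgebraic ℚ a) :
    ∃ g : ℤ[X], Irreducible g ∧ g.IsPrimitive ∧ 0 < g.natDegree ∧ aeval a g = 0 := by
  have ha' : IsAlgebraic ℤ a := (IsFractionRing.isAlgebraic_iff ℤ ℚ E).mpr ha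
  obtain ⟨f, hf0, hf⟩ := ha'
  -- some irreducible factor of `f` vanishes at `a`
  have key : ∀ f : ℤ[X], f ≠ 0 → aeval a f = 0 → ∃ g : ℤ[X], Irreducible g ∧ aeval a g = 0 := by
    intro f
    induction f using WfDvdMonoid.induction_on_irreducible with
    | zero => intro h; exact absurd rfl h
    | unit u hu =>
      intro _ hu0
      obtain ⟨r, hr, rfl⟩ := Polynomial.isUnit_iff.mp hu
      rw [aeval_C, eq_intCast, Int.cast_eq_zero] at hu0
      exact absurd (hu0 ▸ hr) not_isUnit_zero
    | mul f g hf0 hg ih =>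
      intro _ h0
      rw [map_mul, mul_eq_zero] at h0
      rcases h0 with h0 | h0
      · exact ⟨g, hg, h0⟩
      · exact ih hf0 h0
  obtain ⟨g, hg, hga⟩ := key f hf0 hf
  have hdeg : 0 < g.natDegree := by
    refine Nat.pos_of_ne_zero fun h0 => ?_
    have hc : g = C (g.coeff 0) := Polynomial.eq_C_of_natDegree_eq_zero h0
    have hc0 : g.coeff 0 = 0 := by
      rwa [hc, aeval_C, eq_intCast, Int.cast_eq_zero] at hga
    rw [hc0, C_0] at hc
    exact hg.ne_zero hc
  exact ⟨g, hg, isPrimitive_of_irreducible_of_natDegree_pos hg hdeg, hdeg, hga⟩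

/-- If `g ∈ ℤ[X]` is irreducible and primitive with `g(a) = 0`, then `g` divides in `ℤ[X]` every
integer polynomial vanishing at `a` (Gauss's lemma: `g` is, up to a rational constant, the
minimal polynomial of `a`). [folklore] -/
theorem dvd_of_aeval_eq_zero [CharZero E] {a : E} {g : ℤ[X]} (hg : Irreducible g) (hprim : g.IsPrimitive)
    (hga : aeval a g = 0) {f : ℤ[X]} (hfa : aeval a f = 0) : g ∣ f := by
  rw [Polynomial.IsPrimitive.Int.dvd_iff_map_cast_dvd_map_cast g f hprim]
  have hgQ : Irreducible (g.map (Int.castRingHom ℚ)) :=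
    (Polynomial.IsPrimitive.Int.irreducible_iff_irreducible_map_cast hprim).mp hg
  have hgQa : aeval a (g.map (Int.castRingHom ℚ)) = 0 := by
    rwa [show Int.castRingHom ℚ = algebraMap ℤ ℚ from rfl, aeval_map_algebraMap]
  have hfQa : aeval a (f.map (Int.castRingHom ℚ)) = 0 := by
    rwa [show Int.castRingHom ℚ = algebraMap ℤ ℚ from rfl, aeval_map_algebraMap]
  have hint : IsIntegral ℚ a := by
    refine (minpoly.ne_zero_iff (A := ℚ) (x := a)).mp ?_
    intro h0
    have := minpoly.dvd ℚ a hgQa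
    rw [h0, zero_dvd_iff] at this
    exact hgQ.ne_zero this
  have hassoc : Associated (minpoly ℚ a) (g.map (Int.castRingHom ℚ)) :=
    (minpoly.irreducible hint).associated_of_dvd hgQ (minpoly.dvd ℚ a hgQa)
  exact hassoc.dvd_iff_dvd_left.mp (minpoly.dvd ℚ a hfQa)

/-- **Transcendence of the second coordinate.** Let `P ∈ ℤ[x, y]` be irreducible with positive
degree in `x`, and let `P(x₀, x₁) = 0` in a field of characteristic zero with `x₀`
transcendental over `ℚ`. Then `x₁` is transcendental over `ℚ`. [folklore] -/
theorem transcendental_of_aeval_eq_zero [CharZero E] {P : MvPolynomial (Fin 2) ℤ}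
    (hP : Irreducible P) (hd : 0 < P.degreeOf 0) {x₀ x₁ : E} (hx₀ : Transcendental ℚ x₀)
    (h : MvPolynomial.aeval ![x₀, x₁] P = 0) : Transcendental ℚ x₁ := by
  intro hx₁
  -- an irreducible primitive `g ∈ ℤ[X]` of positive degree with `g(x₁) = 0`
  obtain ⟨g, hg, hprim, hgdeg, hgx₁⟩ := exists_irreducible_isPrimitive_aeval_eq_zero hx₁
  -- `P` as a polynomial `PP` in `x` over `ℤ[y]`
  set e₁ : MvPolynomial (Fin 1) ℤ ≃ₐ[ℤ] ℤ[X] := MvPolynomial.uniqueAlgEquiv ℤ (Fin 1) with he₁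
  have he₁X : e₁ (MvPolynomial.X 0) = Polynomial.X := by
    rw [he₁, show (MvPolynomial.X 0 : MvPolynomial (Fin 1) ℤ) =
      MvPolynomial.monomial (Finsupp.single 0 1) 1 from rfl, MvPolynomial.uniqueAlgEquiv_monomial]
    simp [Polynomial.monomial_one_right_eq_X_pow]
  set T : MvPolynomial (Fin 2) ℤ ≃ₐ[ℤ] Polynomial ℤ[X] :=
    (MvPolynomial.finSuccEquiv ℤ 1).trans (Polynomial.mapAlgEquiv e₁) with hT
  have hTX0 : T (MvPolynomial.X 0) = Polynomial.X := by
    rw [hT, AlgEquiv.trans_apply, MvPolynomial.finSuccEquiv_X_zero, Polynomial.coe_mapAlgEquiv,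
      Polynomial.map_X]
  have hTX1 : T (MvPolynomial.X 1) = Polynomial.C Polynomial.X := by
    have h1 : (MvPolynomial.X 1 : MvPolynomial (Fin 2) ℤ) = MvPolynomial.X (0 : Fin 1).succ := rfl
    rw [h1, hT, AlgEquiv.trans_apply, MvPolynomial.finSuccEquiv_X_succ, Polynomial.coe_mapAlgEquiv,
      Polynomial.map_C, RingHom.coe_coe, he₁X]
  set PP : Polynomial ℤ[X] := T P with hPP
  have hPPirr : Irreducible PP := (MulEquiv.irreducible_iff T).mpr hP
  have hPPdeg : PP.natDegree = P.degreeOf 0 := by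
    rw [hPP, hT, AlgEquiv.trans_apply, Polynomial.coe_mapAlgEquiv,
      Polynomial.natDegree_map_eq_of_injective (f := (e₁ : MvPolynomial (Fin 1) ℤ →+* ℤ[X]))
        e₁.injective, MvPolynomial.natDegree_finSuccEquiv]
  -- evaluation: map the coefficients by `ρ : ℤ[y] → E`, `y ↦ x₁`, then evaluate at `x₀`
  set ρ : ℤ[X] →+* E := (aeval x₁ : ℤ[X] →ₐ[ℤ] E).toRingHom with hρ
  have heval : (PP.map ρ).eval x₀ = 0 := by
    rw [← h]
    let F : MvPolynomial (Fin 2) ℤ →+* E :=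
      (evalRingHom x₀).comp ((mapRingHom ρ).comp (T : MvPolynomial (Fin 2) ℤ →+* Polynomial ℤ[X]))
    have hF : F = (MvPolynomial.aeval ![x₀, x₁] : MvPolynomial (Fin 2) ℤ →ₐ[ℤ] E).toRingHom := by
      refine MvPolynomial.ringHom_ext (fun r => by simp [F]) (fun i => ?_)
      fin_cases i
      · simp [F, hTX0]
      · simp [F, hTX1, hρ]
    exact RingHom.congr_fun hF P
  -- the coefficients `ρ (PP.coeff i)` lie in `L = ℚ(x₁)`, over which `x₀` is transcendental
  set L : IntermediateField ℚ E := IntermediateField.adjoin ℚ {x₁} with hL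
  have hint : IsIntegral ℚ x₁ := hx₁.isIntegral
  haveI : FiniteDimensional ℚ L := IntermediateField.adjoin.finiteDimensional hint
  have hx₀L : Transcendental L x₀ := fun halg =>
    hx₀ (isIntegral_trans x₀ halg.isIntegral).isAlgebraic
  have hcoefL : ∀ i, (PP.map ρ).coeff i ∈ Set.range (algebraMap L E) := by
    intro i
    rw [Polynomial.coeff_map]
    have hmem : ρ (PP.coeff i) ∈ L := by
      have h1 : (aeval x₁ (PP.coeff i) : E) ∈ Algebra.adjoin ℤ {x₁} :=
        Polynomial.aeval_mem_adjoin_singleton ℤ x₁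
      rw [Algebra.adjoin_int] at h1
      have h2 : Subring.closure {x₁} ≤ L.toSubring :=
        Subring.closure_le.mpr (Set.singleton_subset_iff.mpr
          (IntermediateField.mem_adjoin_simple_self ℚ x₁))
      exact h2 h1
    exact ⟨⟨_, hmem⟩, rfl⟩
  obtain ⟨q, hq⟩ := (Polynomial.mem_lifts _).mp ((Polynomial.lifts_iff_coeff_lifts _).mpr hcoefL)
  have hq0 : q = 0 := by
    by_contra hq0
    exact hx₀L ⟨q, hq0, by rw [Polynomial.aeval_def, Polynomial.eval₂_eq_eval_map, hq, heval]⟩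
  have hzero : PP.map ρ = 0 := by rw [← hq, hq0, Polynomial.map_zero]
  -- hence every coefficient of `PP` vanishes at `x₁`, so `g` divides `PP`
  have hdvd : Polynomial.C g ∣ PP := by
    rw [Polynomial.C_dvd_iff_dvd_coeff]
    intro i
    refine dvd_of_aeval_eq_zero hg hprim hgx₁ ?_
    have := congr_arg (fun p => Polynomial.coeff p i) hzero
    simpa [Polynomial.coeff_map, hρ] using this
  -- contradiction with the irreducibility of `PP` (`deg g > 0`, `deg_x PP > 0`)
  obtain ⟨R, hR⟩ := hdvd
  rcases hPPirr.isUnit_or_isUnit hR with hu | hu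
  · have := Polynomial.natDegree_eq_zero_of_isUnit (Polynomial.isUnit_C.mp hu)
    omega
  · obtain ⟨u, -, rfl⟩ := Polynomial.isUnit_iff.mp hu
    have : PP.natDegree = 0 := by rw [hR, ← Polynomial.C_mul, Polynomial.natDegree_C]
    omega

/-- **Transcendence of the first coordinate** (the symmetric statement): if `P ∈ ℤ[x, y]` is
irreducible with positive degree in `y`, `P(x₀, x₁) = 0` and `x₁` is transcendental over `ℚ`,
then `x₀` is transcendental over `ℚ`. In particular a zero `(ε, τ)` of an irreducible `P` with
`deg_x P, deg_y P > 0` and `τ` transcendental is a generic zero. [folklore] -/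
theorem transcendental_of_aeval_eq_zero' [CharZero E] {P : MvPolynomial (Fin 2) ℤ}
    (hP : Irreducible P) (hd : 0 < P.degreeOf 1) {x₀ x₁ : E} (hx₁ : Transcendental ℚ x₁)
    (h : MvPolynomial.aeval ![x₀, x₁] P = 0) : Transcendental ℚ x₀ := by
  set σ : Fin 2 ≃ Fin 2 := Equiv.swap 0 1 with hσ
  have hP' : Irreducible (MvPolynomial.rename σ P) :=
    (MulEquiv.irreducible_iff (MvPolynomial.renameEquiv ℤ σ)).mpr hP
  have hd' : 0 < (MvPolynomial.rename σ P).degreeOf 0 := by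
    have : σ 1 = 0 := by simp [hσ]
    rw [← this, MvPolynomial.degreeOf_rename_of_injective σ.injective]
    exact hd
  have h' : MvPolynomial.aeval ![x₁, x₀] (MvPolynomial.rename σ P) = 0 := by
    rw [MvPolynomial.aeval_rename]
    have : (![x₁, x₀] ∘ σ : Fin 2 → E) = ![x₀, x₁] := by
      ext i; fin_cases i <;> simp [hσ]
    rw [this, h]
  exact transcendental_of_aeval_eq_zero hP' hd' hx₁ h'

end PlaneCurve

end Literature.NumberTheory.Transcendental

end
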